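import Literature.NumberTheory.EllipticCurves.FrobeniusTateModuleProofs
import Literature.NumberTheory.EllipticCurves.IsogenyDeterminantProofs
import Literature.NumberTheory.EllipticCurves.FrobeniusManinProofs
import HarnessLib

/-!
# `tr(φ_ℓ) = q + 1 - #E(k)` (Silverman, *AEC*, Thm. V.2.3.1): the trace fact proved

Topic `NumberTheory/EllipticCurves` (trunk T-ELLARITH); a `…Proofs` sibling of
`Literature.NumberTheory.EllipticCurves.FrobeniusTateModule` **discharging its named fact
`WeierstrassCurve.trace_galoisRepTate_frobenius W ℓ`** (Silverman, *AEC*, 2nd ed., Thm. V.2.3.1,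
proof, PDF p. 130, and Remark V.2.6: for an elliptic curve `E` over a finite field `k` with `q`
elements, a prime `ℓ ≠ char k` and the arithmetic Frobenius `σ_q ∈ Γ_k`,
`tr(σ_q | T_ℓ E) = q + 1 - #E(k)`): `WeierstrassCurve.trace_galoisRepTate_frobenius_holds`.
Together with `WeierstrassCurve.det_galoisRepTate_frobenius_holds` of
`FrobeniusTateModuleProofs` (Part 2: `det(σ_q | T_ℓ E) = q`, from the Weil pairing, now proved in
`WeilPairingProofs`) this makes Thm. V.2.3.1 a theorem of the tree:
`charpoly_galoisRepTate_frobenius_eq` (`det(T - φ_ℓ) = T² - aT + q`, `a = q + 1 - #E(k)`, for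
every `ℓ ≠ char k`; in particular the characteristic polynomial has coefficients in `ℤ`
independent of `ℓ`).

## The proof

Silverman's printed proof of the trace (`tr φ_ℓ = 1 + deg φ - deg(1 - φ)`, Prop. III.8.6 at
`1 - φ`, PDF p. 130) needs `det ψ_ℓ = deg ψ` for the endomorphism `ψ = 1 - φ`, i.e. the Weil
pairing *with its adjointness* `e(ψ S, T) = e(S, ψ̂ T)` (Prop. III.8.2) or the quadratic form
`deg` on `End(E)` (Cor. III.6.3), neither of which the tree proves. We use instead the relation
**`φ² - aφ + q = 0` in `End_k(E)`** (Thm. V.2.3.1(b)), which the tree proves *independently of the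
Tate module* by Manin's elementary method (`WeierstrassCurve.frobenius_sq_sub_trace_smul_add_card_smul`
of `Literature.NumberTheory.EllipticCurves.FrobeniusManinProofs`: `σ_q² T - a σ_q T + q T = O`
for all `T ∈ E(k̄)`), and argue as follows (`A = φ_ℓ = σ_q | T_ℓ E`, a `ℤ_ℓ`-linear endomorphism
of the free rank-two module `T_ℓ E`):

1. `A² - aA + q = 0` in `End(T_ℓ E)` (`galoisRepTate_frobenius_sq_sub_smul_add_smul_eq_zero`;
   `T_ℓ` is functorial by components — this holds at every prime `ℓ`, also `ℓ = char k`).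
2. Cayley–Hamilton gives `A² - tr(A) A + det(A) = 0`; subtracting,
   `(tr A - a) A = (det A - q) · 1`, so either `tr A = a` (done) or `A = c · 1` is a scalar
   (`exists_eq_smul_id_or_trace_eq_and_det_eq` of `IsogenyDeterminantProofs`).
3. In the scalar case `det A = c² = q` (`det_galoisRepTate_frobenius_holds`) and step 1 reads
   `c² - ac + q = 0`, whence `c (2c - a) = 0`; `c ≠ 0` because `q ≠ 0` in `ℤ_ℓ`, so `a = 2c = tr A`.

(Geometrically the scalar case is that of a supersingular curve with `φ = [±√q] ∈ ℤ`; the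
argument does not need to know this.)

## Contents (all proved; nothing is defined)

* `WeierstrassCurve.frobeniusIsogeny_comp_sub_smul_add_smul_id_eq_zero` — V.2.3.1(b) as an
  identity `φ ∘ φ - a • φ + q • 1 = 0` in `End(E(k̄))` for `φ = frobeniusIsogeny W hσ`.
* `WeierstrassCurve.galoisRepTate_frobenius_sq_sub_smul_add_smul_eq_zero` — V.2.3.1(b) on
  `T_ℓ E`, every prime `ℓ` (the unconditional form of `galoisRepTate_frobenius_sq_sub_add` of
  `FrobeniusTateModule`, which derived it from the two named facts for `ℓ ≠ char k`).
* `WeierstrassCurve.trace_galoisRepTate_frobenius_holds` — **the discharge**.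
* `WeierstrassCurve.charpoly_galoisRepTate_frobenius_eq` — Thm. V.2.3.1 (proof):
  `charpoly(φ_ℓ) = T² - aT + q` on `T_ℓ E`, `ℓ ≠ char k`, unconditionally.

## References

* [SilvermanAEC2009] J. H. Silverman, *The Arithmetic of Elliptic Curves*, 2nd ed., GTM 106,
  Springer 2009 (held: `book:silverman2009-arithmetic-elliptic-curves-2nd-ed`): Thm. V.2.3.1 with
  its proof (PDF pp. 129–130), Remark V.2.6 (PDF p. 131), Prop. III.8.6 (PDF p. 92).
* [Tate1966Endomorphisms] J. Tate, *Endomorphisms of abelian varieties over finite fields*,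
  Invent. Math. 2 (1966), 134–144, §3 (the characteristic polynomial of Frobenius), for context.

## Design

Pure theorems; `noncomputable section`, `open scoped Classical`, universe `u`, dot-notation
extensions in `namespace WeierstrassCurve` with `(W : WeierstrassCurve K) (ℓ : ℕ) [Fact ℓ.Prime]`
explicit, as in `FrobeniusTateModule(Proofs)`. The file imports `IsogenyDeterminantProofs` only
for its two linear-algebra lemmas on `T_ℓ E ≅ ℤ_ℓ²` (`TateModule.map_mul_map_sub_smul_add_smul_one_eq_zero`,
`exists_eq_smul_id_or_trace_eq_and_det_eq`); it is a new file rather than a Part 3 of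
`FrobeniusTateModuleProofs` because `IsogenyDeterminantProofs` imports the latter.
-/

noncomputable section

open scoped Classical

universe u

namespace WeierstrassCurve

open Literature.NumberTheory.EllipticCurves Polynomial

variable {K : Type u} [Field K] (W : WeierstrassCurve K)

/-! ## Thm. V.2.3.1(b): `φ² - aφ + q = 0` in `End(E(k̄))` and on `T_ℓ E` -/

section Relation

variable [W.IsElliptic] [Finite K] {σ : Field.absoluteGaloisGroup K}
  (hσ : ∀ x : AlgebraicClosure K, σ • x = x ^ Nat.card K)
include hσ

/-- **`φ ∘ φ - a • φ + q • 1 = 0` in `End(E(k̄))`** for the Frobenius isogeny `φ = frobeniusIsogeny W hσ`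
of an elliptic curve over a finite field `k` with `q` elements, `a = q + 1 - #E(k)`: the pointwise
identity `frobenius_sq_sub_trace_smul_add_card_smul` of `FrobeniusManinProofs` (Manin's
elementary proof) as an identity of additive endomorphisms. Silverman, *AEC*, Thm. V.2.3.1(b).
[cite: SilvermanAEC2009, Thm. V.2.3.1(b)] -/
theorem frobeniusIsogeny_comp_sub_smul_add_smul_id_eq_zero :
    (W.frobeniusIsogeny hσ).toAddMonoidHom.comp (W.frobeniusIsogeny hσ).toAddMonoidHom
      - ((Nat.card K : ℤ) + 1 - Nat.card W.toAffine.Point : ℤ) • (W.frobeniusIsogeny hσ).toAddMonoidHom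
      + ((Nat.card K : ℕ) : ℤ) • AddMonoidHom.id W.geomPoints = 0 := by
  letI := Fintype.ofFinite K
  refine AddMonoidHom.ext fun T ↦ ?_
  have h := frobenius_sq_sub_trace_smul_add_card_smul W hσ T
  rw [HasseManin.tr, ← Nat.card_eq_fintype_card] at h
  exact h

/-- **Thm. V.2.3.1(b) on the Tate module, unconditionally and at every prime `ℓ`**: the
Frobenius `φ_ℓ = σ_q | T_ℓ E` satisfies `φ_ℓ² - a φ_ℓ + q = 0` in `End_{ℤ_ℓ}(T_ℓ E)`,
`a = q + 1 - #E(k)` (from the identity in `End(E(k̄))`, `T_ℓ` being functorial by components;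
`T_ℓ(φ) = φ_ℓ` is `tateModule_map_frobeniusIsogeny`). Silverman, *AEC*, Thm. V.2.3.1(b) (there
for `ℓ ≠ char k`, via Cayley–Hamilton). [cite: SilvermanAEC2009, Thm. V.2.3.1(b)] -/
theorem galoisRepTate_frobenius_sq_sub_smul_add_smul_eq_zero (ℓ : ℕ) [Fact ℓ.Prime] :
    W.galoisRepTate ℓ σ * W.galoisRepTate ℓ σ
      - ((Nat.card K : ℤ_[ℓ]) + 1 - Nat.card W.toAffine.Point) • W.galoisRepTate ℓ σ
      + (Nat.card K : ℤ_[ℓ]) • (1 : W.tateModule ℓ →ₗ[ℤ_[ℓ]] W.tateModule ℓ) = 0 := by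
  have h := TateModule.map_mul_map_sub_smul_add_smul_one_eq_zero ℓ
    (frobeniusIsogeny_comp_sub_smul_add_smul_id_eq_zero W hσ)
  rw [tateModule_map_frobeniusIsogeny] at h
  push_cast at h
  exact h

end Relation

/-! ## The discharge: `tr(φ_ℓ) = q + 1 - #E(k)` -/

section Trace

variable (ℓ : ℕ) [Fact ℓ.Prime]

/-- **Discharge of the named fact `trace_galoisRepTate_frobenius W ℓ`** (Silverman, *AEC*,
Thm. V.2.3.1, proof, and Remark V.2.6: `tr(φ_ℓ) = 1 + q - #E(𝔽_q)` for the arithmetic Frobenius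
on `T_ℓ E`, `ℓ ≠ char k`). Proof (module docstring): `φ_ℓ² - aφ_ℓ + q = 0`
(`galoisRepTate_frobenius_sq_sub_smul_add_smul_eq_zero`, from Thm. V.2.3.1(b) in `End_k(E)` by
Manin's method) and Cayley–Hamilton give `tr φ_ℓ = a` unless `φ_ℓ = c` is a scalar; then
`c² = det φ_ℓ = q` (`det_galoisRepTate_frobenius_holds`, Weil pairing) and `c² - ac + q = 0` give
`c(2c - a) = 0` with `c ≠ 0`, so `tr φ_ℓ = 2c = a`. [cite: SilvermanAEC2009, Thm. V.2.3.1 (proof) and Remark V.2.6] -/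
theorem trace_galoisRepTate_frobenius_holds : W.trace_galoisRepTate_frobenius ℓ := by
  intro _ _ hℓ σ hσ
  haveI := module_free_tateModule_holds W ℓ
  haveI := module_finite_tateModule_holds W ℓ
  have hrel := galoisRepTate_frobenius_sq_sub_smul_add_smul_eq_zero W hσ ℓ
  rcases exists_eq_smul_id_or_trace_eq_and_det_eq W ℓ hℓ _ hrel with ⟨c, hc⟩ | h
  · -- the scalar case `φ_ℓ = c`
    have h2 := finrank_tateModule_eq_two_holds W ℓ hℓ
    have hdet := det_galoisRepTate_frobenius_holds W ℓ hℓ σ hσ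
    rw [hc, LinearMap.det_smul, LinearMap.det_id, mul_one, h2] at hdet
    -- `hdet : c ^ 2 = q`
    let b := Module.finBasisOfFinrankEq ℤ_[ℓ] (W.tateModule ℓ) h2
    have h1 := congrArg (fun f : W.tateModule ℓ →ₗ[ℤ_[ℓ]] W.tateModule ℓ ↦ b.repr (f (b 0)) 0) hrel
    simp only [hc, LinearMap.sub_apply, LinearMap.add_apply, LinearMap.smul_apply,
      Module.End.mul_apply, LinearMap.id_apply, Module.End.one_apply, map_smul, map_sub, map_add,
      Finsupp.smul_apply, Finsupp.sub_apply, Finsupp.add_apply, smul_eq_mul,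
      Module.Basis.repr_self, Finsupp.single_eq_same, mul_one, LinearMap.zero_apply, map_zero,
      Finsupp.coe_zero, Pi.zero_apply] at h1
    -- `h1 : c * c - a * c + q = 0`
    have hq : (Nat.card K : ℤ_[ℓ]) ≠ 0 := by
      haveI : Finite K := ‹Finite K›
      have : 0 < Nat.card K := Nat.card_pos
      exact_mod_cast this.ne'
    have hc0 : c ≠ 0 := by
      rintro rfl
      apply hq
      rw [← hdet]
      ring
    have key : ((Nat.card K : ℤ_[ℓ]) + 1 - Nat.card W.toAffine.Point) * c = (c * 2) * c := by
      linear_combination (-1 : ℤ_[ℓ]) * h1 - hdet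
    rw [hc, _root_.map_smul, LinearMap.trace_id, h2, Nat.cast_ofNat, smul_eq_mul]
    exact (mul_right_cancel₀ hc0 key).symm
  · exact h.1

/-- **Silverman, *AEC*, Thm. V.2.3.1 (proof), unconditionally**: for an elliptic curve `E` over a
finite field `k` with `q` elements and a prime `ℓ ≠ char k`, the characteristic polynomial of the
Frobenius `φ_ℓ` on `T_ℓ E` is `T² - aT + q`, `a = q + 1 - #E(k)` — in particular it has integer
coefficients independent of `ℓ` (`charpoly_galoisRepTate_frobenius` of `FrobeniusTateModule` fed
with the two discharged facts). [cite: SilvermanAEC2009, Thm. V.2.3.1 (proof)] -/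
theorem charpoly_galoisRepTate_frobenius_eq [Finite K] [W.IsElliptic] (hℓ : (ℓ : K) ≠ 0)
    {σ : Field.absoluteGaloisGroup K} (hσ : ∀ x : AlgebraicClosure K, σ • x = x ^ Nat.card K) :
    haveI := module_free_tateModule_holds W ℓ
    haveI := module_finite_tateModule_holds W ℓ
    (W.galoisRepTate ℓ σ).charpoly =
      X ^ 2 - C ((Nat.card K : ℤ_[ℓ]) + 1 - Nat.card W.toAffine.Point) * X + C (Nat.card K : ℤ_[ℓ]) :=
  charpoly_galoisRepTate_frobenius (trace_galoisRepTate_frobenius_holds W ℓ)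
    (det_galoisRepTate_frobenius_holds W ℓ) hℓ hσ

/-- **The trace of Frobenius is an integer independent of `ℓ`**: for primes `ℓ, ℓ' ≠ char k` the
traces of `σ_q` on `T_ℓ E` and `T_{ℓ'} E` are the images of the same integer `q + 1 - #E(k)`.
Silverman, *AEC*, Thm. V.2.3.1 / Remark V.2.6 ("`a` is an integer independent of `ℓ`").
[cite: SilvermanAEC2009, Thm. V.2.3.1 and Remark V.2.6] -/
theorem trace_galoisRepTate_frobenius_eq_intCast [Finite K] [W.IsElliptic] (hℓ : (ℓ : K) ≠ 0)
    {σ : Field.absoluteGaloisGroup K} (hσ : ∀ x : AlgebraicClosure K, σ • x = x ^ Nat.card K) :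
    LinearMap.trace ℤ_[ℓ] (W.tateModule ℓ) (W.galoisRepTate ℓ σ) =
      (((Nat.card K : ℤ) + 1 - Nat.card W.toAffine.Point : ℤ) : ℤ_[ℓ]) := by
  rw [trace_galoisRepTate_frobenius_holds W ℓ hℓ σ hσ]
  push_cast
  ring

end Trace

end WeierstrassCurve
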